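import Summits.ValiantsHypothesis.ValiantsHypothesis.Theorems.LacunarySymmetroidMatrixDescartesDoorA26WallBubblingTwoScaleTripleMid

/-!
# Wall bubbling for `DoorA26` — (W-split) rung 4: THE TRIPLE CLASS ACROSS THREE SCALES («the confluent t-slot lives in at most two clusters»)

HONEST FRAMING.  Chain lemma for obligation (W) `stub_weylFaces` of `Cruxes/DoorA26/Lines/wall_bubbling.lean` (stmt-ValiantsHypothesis-19979
`DoorA26`; OPEN, typed, never asserted), W2 seat val-sym-door-p1 g14; named residual «(W-split) multi-scale linking» (register R2761).  With
`…TwoScaleDoubletonSplit` (p667161), `…TwoScaleTripleTop` (p669316) and `…TwoScaleTripleMid` (p669957) this is the LAST input of the slot-splitting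
rule `hsplit` of the count `…ChainCeiling.chain_ceiling` (p663233): the triple value `2α` (slots `(0,0)`, `(0,5)`, `(5,5)`; degrees 0/1/2) cannot
carry its confluent `t`-slot `(0,5)` at THREE clusters — the degree profile `(1,1,1)` is excluded.  So after this file every hypothesis of the
count is a kernel theorem about confluent limits of twenties at a generic Weyl face (hcount: W1 #12 + W2 #5; hmono: #18; hsplit: #19, #20a/b, this
file), and the count's ceiling is 20, attained abstractly (`chain_ceiling_attained_two_clusters`): (W-split) proper is a statement about PENCILS.

MECHANISM (door-free, elementary).  Three clusters = ONE letter sequence `U^ν` seen at log-distances `0`, `L₁`, `L₁ + L₂` (`L₁, L₂ → +∞`).  With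
`u_c := g₀₅ + Λ_{1c}·g₅₅` (the `t`-slot at cluster `c` transported to the first frame; `Λ_{11} = 0`, `Λ_{1c} = dslope (y ↦ e^{y(L)}) 0 w` for the
distance `L` to `c`), the frame identity `triple_frameShift` gives `g₀₀^{(c)} ∝ g₀₀ + Λ_{1c}(u_1 + u_c)` and `Λ₁₃ − Λ₁₂ = e^{wL₁}·Λ₂₃`
(`dslope_exp_shift_sub`); «`t`-slot dominates the `(0,0)`-slot at `c`» then forces `|u_c + u_{c'}| ≤ ε(|u_c| + |u_{c'}|)` for every pair, with
`ε → 0` (`eventually_dslope_exp_gt`), and three pairwise near-opposite reals vanish: `Σ|u| ≤ 3εΣ|u|` (`three_opposite_core`).  But `|u₁| = |g₀₅| ≥ κμ > 0`.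

* `dslope_exp_shift_sub` — `dslope (e^{·(L₁+L₂)}) 0 w − dslope (e^{·L₁}) 0 w = e^{wL₁} · dslope (e^{·L₂}) 0 w`;
* `three_opposite_core` — the scalar core;
* **`threeScale_triple`** — hypotheses in the currency of `twoScale_monotone` at the three scales; `Γ₁ 0 5 ≠ 0 → Γ₂ 0 5 ≠ 0 → Γ₃ 0 5 ≠ 0 → False`.

No new definitions; nothing here bears on `DoorA26`, `MatrixDescartes` (stmt-ValiantsHypothesis-18050) or `VP ≠ VNP`.

[this work] three-scale bookkeeping of the triple class.
-/

-- `Summit.ValiantsHypothesis.ValiantsHypothesis.…` repeats a component by the D-0017 layout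
-- (single-conjunct summit), which the `dupNamespace` linter flags; the name is mandated.
set_option linter.dupNamespace false

namespace Summit.ValiantsHypothesis.ValiantsHypothesis.Theorems.LacunarySymmetroidMatrixDescartes.WallBubbling

open Finset Filter Topology
open Bubbling (polar polar_apply polar_comm polar_smul_left_right)
open scoped BigOperators

/-! ## 1. The transvection coefficients of nested shifts -/

/-- `Λ(L₁ + L₂) − Λ(L₁) = e^{wL₁}·Λ(L₂)` for the divided differences `Λ(L) = dslope (y ↦ e^{yL}) 0 w`. [folklore] -/
theorem dslope_exp_shift_sub (L₁ L₂ w : ℝ) :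
    dslope (fun y : ℝ => Real.exp (y * (L₁ + L₂))) 0 w - dslope (fun y : ℝ => Real.exp (y * L₁)) 0 w
      = Real.exp (w * L₁) * dslope (fun y : ℝ => Real.exp (y * L₂)) 0 w := by
  by_cases hw : w = 0
  · subst hw
    rw [dslope_exp_same, dslope_exp_same, dslope_exp_same]
    simp
  · have h1 := sub_mul_dslope_exp 0 w (L₁ + L₂)
    have h2 := sub_mul_dslope_exp 0 w L₁
    have h3 := sub_mul_dslope_exp 0 w L₂
    rw [zero_mul, Real.exp_zero, sub_zero] at h1 h2 h3
    have key : w * (dslope (fun y : ℝ => Real.exp (y * (L₁ + L₂))) 0 w - dslope (fun y : ℝ => Real.exp (y * L₁)) 0 w)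
        = w * (Real.exp (w * L₁) * dslope (fun y : ℝ => Real.exp (y * L₂)) 0 w) := by
      rw [mul_sub, h1, h2, ← mul_assoc, mul_comm w (Real.exp _), mul_assoc, h3, mul_add, Real.exp_add]
      ring
    exact mul_left_cancel₀ hw key

/-! ## 2. Scalar core: three pairwise near-opposite reals vanish -/

/-- Three reals that are pairwise «near-opposite» (`|u + u'| ≤ ε(|u| + |u'|)` with `ε < 1/3`) are all zero; here packaged with the sources of
the three inequalities: `t`-slot dominance of the `(0,0)`-slot at three clusters. [this work] -/
theorem three_opposite_core {κ₁ κ₂ κ₃ μ g₀₀ g₀₅ g₅₅ Λ₂ Λ₃ D e₂ e₃ : ℝ} (hκ₁ : 0 < κ₁) (hκ₂ : 0 < κ₂) (hκ₃ : 0 < κ₃) (hμ : 0 < μ)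
    (he₂ : 0 < e₂)
    (h1 : κ₁ * μ ≤ |g₀₅|) (h00 : |g₀₀| ≤ μ)
    (h2 : κ₂ * |g₀₀ + 2 * Λ₂ * g₀₅ + Λ₂ * Λ₂ * g₅₅| ≤ e₂ * |g₀₅ + Λ₂ * g₅₅|)
    (h3 : κ₃ * |g₀₀ + 2 * Λ₃ * g₀₅ + Λ₃ * Λ₃ * g₅₅| ≤ e₃ * |g₀₅ + Λ₃ * g₅₅|)
    (hD : Λ₃ - Λ₂ = D)
    (hΛ₂a : 8 ≤ κ₁ * |Λ₂|) (hΛ₂b : 8 * e₂ ≤ κ₂ * |Λ₂|)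
    (hΛ₃a : 8 ≤ κ₁ * |Λ₃|) (hΛ₃b : 8 * e₃ ≤ κ₃ * |Λ₃|)
    (hDa : 8 * e₂ ≤ κ₂ * |D|) (hDb : 8 * e₃ ≤ κ₃ * |D|) : False := by
  -- the three transported t-slots
  set u₁ := g₀₅ with hu₁
  set u₂ := g₀₅ + Λ₂ * g₅₅ with hu₂
  set u₃ := g₀₅ + Λ₃ * g₅₅ with hu₃
  have hu₁pos : 0 < |u₁| := lt_of_lt_of_le (mul_pos hκ₁ hμ) h1
  have hg00 : |g₀₀| ≤ |u₁| / κ₁ := by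
    rw [le_div_iff₀ hκ₁]
    calc |g₀₀| * κ₁ ≤ μ * κ₁ := mul_le_mul_of_nonneg_right h00 hκ₁.le
      _ ≤ |u₁| := by linarith
  -- identities
  have i2 : g₀₀ + 2 * Λ₂ * g₀₅ + Λ₂ * Λ₂ * g₅₅ = g₀₀ + Λ₂ * (u₁ + u₂) := by rw [hu₁, hu₂]; ring
  have i3 : g₀₀ + 2 * Λ₃ * g₀₅ + Λ₃ * Λ₃ * g₅₅ = g₀₀ + Λ₃ * (u₁ + u₃) := by rw [hu₁, hu₃]; ring
  have i23 : (g₀₀ + Λ₃ * (u₁ + u₃)) - (g₀₀ + Λ₂ * (u₁ + u₂)) = D * (u₂ + u₃) := by rw [← hD, hu₁, hu₂, hu₃]; ring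
  rw [i2] at h2
  rw [i3] at h3
  have hΛ₂ : 0 < |Λ₂| := lt_of_mul_lt_mul_left (show κ₁ * 0 < κ₁ * |Λ₂| by rw [mul_zero]; linarith) hκ₁.le
  have hΛ₃ : 0 < |Λ₃| := lt_of_mul_lt_mul_left (show κ₁ * 0 < κ₁ * |Λ₃| by rw [mul_zero]; linarith) hκ₁.le
  have hDpos : 0 < |D| := lt_of_mul_lt_mul_left (show κ₂ * 0 < κ₂ * |D| by rw [mul_zero]; nlinarith [he₂]) hκ₂.le
  -- (1,2): |Λ₂| |u₁+u₂| ≤ |g₀₀| + e₂|u₂|/κ₂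
  have p12 : |Λ₂| * |u₁ + u₂| ≤ |u₁| / κ₁ + e₂ * |u₂| / κ₂ := by
    have t : |Λ₂ * (u₁ + u₂)| ≤ |g₀₀ + Λ₂ * (u₁ + u₂)| + |g₀₀| := by
      have := abs_sub_abs_le_abs_sub (Λ₂ * (u₁ + u₂)) (-g₀₀)
      rw [abs_neg, show Λ₂ * (u₁ + u₂) - -g₀₀ = g₀₀ + Λ₂ * (u₁ + u₂) by ring] at this
      linarith
    have t' : |g₀₀ + Λ₂ * (u₁ + u₂)| ≤ e₂ * |u₂| / κ₂ := by rw [le_div_iff₀ hκ₂]; linarith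
    rw [← abs_mul]; linarith
  have p13 : |Λ₃| * |u₁ + u₃| ≤ |u₁| / κ₁ + e₃ * |u₃| / κ₃ := by
    have t : |Λ₃ * (u₁ + u₃)| ≤ |g₀₀ + Λ₃ * (u₁ + u₃)| + |g₀₀| := by
      have := abs_sub_abs_le_abs_sub (Λ₃ * (u₁ + u₃)) (-g₀₀)
      rw [abs_neg, show Λ₃ * (u₁ + u₃) - -g₀₀ = g₀₀ + Λ₃ * (u₁ + u₃) by ring] at this
      linarith
    have t' : |g₀₀ + Λ₃ * (u₁ + u₃)| ≤ e₃ * |u₃| / κ₃ := by rw [le_div_iff₀ hκ₃]; linarith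
    rw [← abs_mul]; linarith
  have p23 : |D| * |u₂ + u₃| ≤ e₂ * |u₂| / κ₂ + e₃ * |u₃| / κ₃ := by
    have t : |D * (u₂ + u₃)| ≤ |g₀₀ + Λ₃ * (u₁ + u₃)| + |g₀₀ + Λ₂ * (u₁ + u₂)| := by
      rw [← i23]; exact abs_sub _ _
    have t2 : |g₀₀ + Λ₂ * (u₁ + u₂)| ≤ e₂ * |u₂| / κ₂ := by rw [le_div_iff₀ hκ₂]; linarith
    have t3 : |g₀₀ + Λ₃ * (u₁ + u₃)| ≤ e₃ * |u₃| / κ₃ := by rw [le_div_iff₀ hκ₃]; linarith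
    rw [← abs_mul]; linarith
  -- divide: every coefficient is ≤ 1/8
  have eighth : ∀ {x k m c : ℝ}, 0 < k → 0 ≤ c → 8 * x ≤ k * m → x * c / k ≤ m * c / 8 := by
    intro x k m c hk hc hx
    rw [div_le_div_iff₀ hk (by norm_num)]
    calc x * c * 8 = c * (8 * x) := by ring
      _ ≤ c * (k * m) := mul_le_mul_of_nonneg_left hx hc
      _ = m * c * k := by ring
  have q12 : |u₁ + u₂| ≤ (|u₁| + |u₂|) / 8 := by
    have a : 1 * |u₁| / κ₁ ≤ |Λ₂| * |u₁| / 8 := eighth hκ₁ (abs_nonneg _) (by linarith)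
    have b : e₂ * |u₂| / κ₂ ≤ |Λ₂| * |u₂| / 8 := eighth hκ₂ (abs_nonneg _) hΛ₂b
    rw [one_mul] at a
    have : |Λ₂| * |u₁ + u₂| ≤ |Λ₂| * ((|u₁| + |u₂|) / 8) := by linarith
    exact le_of_mul_le_mul_left this hΛ₂
  have q13 : |u₁ + u₃| ≤ (|u₁| + |u₃|) / 8 := by
    have a : 1 * |u₁| / κ₁ ≤ |Λ₃| * |u₁| / 8 := eighth hκ₁ (abs_nonneg _) (by linarith)
    have b : e₃ * |u₃| / κ₃ ≤ |Λ₃| * |u₃| / 8 := eighth hκ₃ (abs_nonneg _) hΛ₃b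
    rw [one_mul] at a
    have : |Λ₃| * |u₁ + u₃| ≤ |Λ₃| * ((|u₁| + |u₃|) / 8) := by linarith
    exact le_of_mul_le_mul_left this hΛ₃
  have q23 : |u₂ + u₃| ≤ (|u₂| + |u₃|) / 8 := by
    have a : e₂ * |u₂| / κ₂ ≤ |D| * |u₂| / 8 := eighth hκ₂ (abs_nonneg _) hDa
    have b : e₃ * |u₃| / κ₃ ≤ |D| * |u₃| / 8 := eighth hκ₃ (abs_nonneg _) hDb
    have : |D| * |u₂ + u₃| ≤ |D| * ((|u₂| + |u₃|) / 8) := by linarith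
    exact le_of_mul_le_mul_left this hDpos
  -- 2u₁ = (u₁+u₂) − (u₂+u₃) + (u₁+u₃)
  have r1 : 2 * |u₁| ≤ |u₁ + u₂| + |u₂ + u₃| + |u₁ + u₃| := by
    have := abs_add_le (u₁ + u₂ - (u₂ + u₃)) (u₁ + u₃)
    have := abs_sub (u₁ + u₂) (u₂ + u₃)
    rw [show u₁ + u₂ - (u₂ + u₃) + (u₁ + u₃) = 2 * u₁ by ring, abs_mul, abs_two] at *
    linarith
  have r2 : 2 * |u₂| ≤ |u₁ + u₂| + |u₁ + u₃| + |u₂ + u₃| := by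
    have := abs_add_le (u₁ + u₂ - (u₁ + u₃)) (u₂ + u₃)
    have := abs_sub (u₁ + u₂) (u₁ + u₃)
    rw [show u₁ + u₂ - (u₁ + u₃) + (u₂ + u₃) = 2 * u₂ by ring, abs_mul, abs_two] at *
    linarith
  have r3 : 2 * |u₃| ≤ |u₁ + u₃| + |u₁ + u₂| + |u₂ + u₃| := by
    have := abs_add_le (u₁ + u₃ - (u₁ + u₂)) (u₂ + u₃)
    have := abs_sub (u₁ + u₃) (u₁ + u₂)
    rw [show u₁ + u₃ - (u₁ + u₂) + (u₂ + u₃) = 2 * u₃ by ring, abs_mul, abs_two] at *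
    linarith
  linarith [abs_nonneg u₂, abs_nonneg u₃]

/-! ## 3. The triple across three scales -/

/-- **THE TRIPLE CLASS ACROSS THREE SCALES.**  One letter sequence `U^ν`, exponents `δ^ν → δ0` (`δ0 5 = δ0 0`), three clusters at log-distances
`0`, `L₁`, `L₁ + L₂` (`L₁, L₂ → +∞`); the Gram-normalised confluent frames converge at the three scales (`Γ₁, Γ₂, Γ₃`, entries dominated by
`μ₁, μ₂, μ₃`).  Then the confluent `t`-slot `(0,5)` of the triple is NOT alive at all three: `Γ₁ 0 5 ≠ 0 → Γ₂ 0 5 ≠ 0 → Γ₃ 0 5 ≠ 0 → False`.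
[this work] -/
theorem threeScale_triple (δs : ℕ → Fin 6 → ℝ) (δ0 : Fin 6 → ℝ)
    (hδ : ∀ l, Tendsto (fun ν => δs ν l) atTop (𝓝 (δ0 l))) (h05 : δ0 5 = δ0 0)
    (U : ℕ → Fin 6 → Matrix (Fin 2) (Fin 2) ℝ) (L₁ L₂ : ℕ → ℝ) (hL₁ : Tendsto L₁ atTop atTop) (hL₂ : Tendsto L₂ atTop atTop)
    (μ₁ μ₂ μ₃ : ℕ → ℝ) (hμ₁ : ∀ ν, 0 < μ₁ ν) (hμ₂ : ∀ ν, 0 < μ₂ ν) (hμ₃ : ∀ ν, 0 < μ₃ ν)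
    (hdom₁ : ∀ ν a b, |polar (if a = 0 then U ν 0 + U ν 5 else if a = 5 then (δs ν 5 - δs ν 0) • U ν 5 else U ν a)
      (if b = 0 then U ν 0 + U ν 5 else if b = 5 then (δs ν 5 - δs ν 0) • U ν 5 else U ν b)| ≤ μ₁ ν)
    (hdom₂ : ∀ ν a b, |polar
      (if a = 0 then Real.exp (δs ν 0 * L₁ ν) • U ν 0 + Real.exp (δs ν 5 * L₁ ν) • U ν 5
        else if a = 5 then (δs ν 5 - δs ν 0) • (Real.exp (δs ν 5 * L₁ ν) • U ν 5) else Real.exp (δs ν a * L₁ ν) • U ν a)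
      (if b = 0 then Real.exp (δs ν 0 * L₁ ν) • U ν 0 + Real.exp (δs ν 5 * L₁ ν) • U ν 5
        else if b = 5 then (δs ν 5 - δs ν 0) • (Real.exp (δs ν 5 * L₁ ν) • U ν 5) else Real.exp (δs ν b * L₁ ν) • U ν b)| ≤ μ₂ ν)
    (hdom₃ : ∀ ν a b, |polar
      (if a = 0 then Real.exp (δs ν 0 * (L₁ ν + L₂ ν)) • U ν 0 + Real.exp (δs ν 5 * (L₁ ν + L₂ ν)) • U ν 5
        else if a = 5 then (δs ν 5 - δs ν 0) • (Real.exp (δs ν 5 * (L₁ ν + L₂ ν)) • U ν 5)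
        else Real.exp (δs ν a * (L₁ ν + L₂ ν)) • U ν a)
      (if b = 0 then Real.exp (δs ν 0 * (L₁ ν + L₂ ν)) • U ν 0 + Real.exp (δs ν 5 * (L₁ ν + L₂ ν)) • U ν 5
        else if b = 5 then (δs ν 5 - δs ν 0) • (Real.exp (δs ν 5 * (L₁ ν + L₂ ν)) • U ν 5)
        else Real.exp (δs ν b * (L₁ ν + L₂ ν)) • U ν b)| ≤ μ₃ ν)
    (Γ₁ Γ₂ Γ₃ : Fin 6 → Fin 6 → ℝ)
    (hΓ₁ : ∀ a b, Tendsto (fun ν => polar (if a = 0 then U ν 0 + U ν 5 else if a = 5 then (δs ν 5 - δs ν 0) • U ν 5 else U ν a)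
      (if b = 0 then U ν 0 + U ν 5 else if b = 5 then (δs ν 5 - δs ν 0) • U ν 5 else U ν b) / μ₁ ν) atTop (𝓝 (Γ₁ a b)))
    (hΓ₂ : ∀ a b, Tendsto (fun ν => polar
      (if a = 0 then Real.exp (δs ν 0 * L₁ ν) • U ν 0 + Real.exp (δs ν 5 * L₁ ν) • U ν 5
        else if a = 5 then (δs ν 5 - δs ν 0) • (Real.exp (δs ν 5 * L₁ ν) • U ν 5) else Real.exp (δs ν a * L₁ ν) • U ν a)
      (if b = 0 then Real.exp (δs ν 0 * L₁ ν) • U ν 0 + Real.exp (δs ν 5 * L₁ ν) • U ν 5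
        else if b = 5 then (δs ν 5 - δs ν 0) • (Real.exp (δs ν 5 * L₁ ν) • U ν 5) else Real.exp (δs ν b * L₁ ν) • U ν b) / μ₂ ν)
      atTop (𝓝 (Γ₂ a b)))
    (hΓ₃ : ∀ a b, Tendsto (fun ν => polar
      (if a = 0 then Real.exp (δs ν 0 * (L₁ ν + L₂ ν)) • U ν 0 + Real.exp (δs ν 5 * (L₁ ν + L₂ ν)) • U ν 5
        else if a = 5 then (δs ν 5 - δs ν 0) • (Real.exp (δs ν 5 * (L₁ ν + L₂ ν)) • U ν 5)
        else Real.exp (δs ν a * (L₁ ν + L₂ ν)) • U ν a)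
      (if b = 0 then Real.exp (δs ν 0 * (L₁ ν + L₂ ν)) • U ν 0 + Real.exp (δs ν 5 * (L₁ ν + L₂ ν)) • U ν 5
        else if b = 5 then (δs ν 5 - δs ν 0) • (Real.exp (δs ν 5 * (L₁ ν + L₂ ν)) • U ν 5)
        else Real.exp (δs ν b * (L₁ ν + L₂ ν)) • U ν b) / μ₃ ν)
      atTop (𝓝 (Γ₃ a b)))
    (h1 : Γ₁ 0 5 ≠ 0) (h2 : Γ₂ 0 5 ≠ 0) (h3 : Γ₃ 0 5 ≠ 0) : False := by
  set κ₁ : ℝ := |Γ₁ 0 5| / 2 with hκ₁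
  set κ₂ : ℝ := |Γ₂ 0 5| / 2 with hκ₂
  set κ₃ : ℝ := |Γ₃ 0 5| / 2 with hκ₃
  have hκ₁pos : 0 < κ₁ := by rw [hκ₁]; exact half_pos (abs_pos.mpr h1)
  have hκ₂pos : 0 < κ₂ := by rw [hκ₂]; exact half_pos (abs_pos.mpr h2)
  have hκ₃pos : 0 < κ₃ := by rw [hκ₃]; exact half_pos (abs_pos.mpr h3)
  have h50 : ((5 : Fin 6) = 0) = False := by simp
  have h05' : ((0 : Fin 6) = 5) = False := by simp
  have hw0 : Tendsto (fun ν => δs ν 5 - δs ν 0) atTop (𝓝 0) := by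
    have := (hδ 5).sub (hδ 0)
    rw [h05, sub_self] at this
    exact this
  have hL₃ : Tendsto (fun ν => L₁ ν + L₂ ν) atTop atTop := hL₁.atTop_add_atTop hL₂
  -- aliveness at the three scales
  have e1 : ∀ᶠ ν in atTop, κ₁ * μ₁ ν ≤ |polar (U ν 0 + U ν 5) ((δs ν 5 - δs ν 0) • U ν 5)| := by
    have h := ((hΓ₁ 0 5).abs).eventually_const_lt (show κ₁ < |Γ₁ 0 5| by rw [hκ₁]; linarith [abs_pos.mpr h1])
    filter_upwards [h] with ν hν
    simp only [h50, h05', if_false, if_true] at hν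
    rw [abs_div, abs_of_pos (hμ₁ ν), lt_div_iff₀ (hμ₁ ν)] at hν
    exact hν.le
  have e2 : ∀ᶠ ν in atTop, κ₂ * μ₂ ν ≤ |polar (Real.exp (δs ν 0 * L₁ ν) • U ν 0 + Real.exp (δs ν 5 * L₁ ν) • U ν 5)
      ((δs ν 5 - δs ν 0) • (Real.exp (δs ν 5 * L₁ ν) • U ν 5))| := by
    have h := ((hΓ₂ 0 5).abs).eventually_const_lt (show κ₂ < |Γ₂ 0 5| by rw [hκ₂]; linarith [abs_pos.mpr h2])
    filter_upwards [h] with ν hν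
    simp only [h50, h05', if_false, if_true] at hν
    rw [abs_div, abs_of_pos (hμ₂ ν), lt_div_iff₀ (hμ₂ ν)] at hν
    exact hν.le
  have e3 : ∀ᶠ ν in atTop, κ₃ * μ₃ ν ≤ |polar (Real.exp (δs ν 0 * (L₁ ν + L₂ ν)) • U ν 0 + Real.exp (δs ν 5 * (L₁ ν + L₂ ν)) • U ν 5)
      ((δs ν 5 - δs ν 0) • (Real.exp (δs ν 5 * (L₁ ν + L₂ ν)) • U ν 5))| := by
    have h := ((hΓ₃ 0 5).abs).eventually_const_lt (show κ₃ < |Γ₃ 0 5| by rw [hκ₃]; linarith [abs_pos.mpr h3])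
    filter_upwards [h] with ν hν
    simp only [h50, h05', if_false, if_true] at hν
    rw [abs_div, abs_of_pos (hμ₃ ν), lt_div_iff₀ (hμ₃ ν)] at hν
    exact hν.le
  -- the six growth conditions on the transvection coefficients
  have g2a : ∀ᶠ ν in atTop, 0 * Real.exp ((δs ν 5 - δs ν 0) * L₁ ν) + 8 / κ₁
      < |dslope (fun y : ℝ => Real.exp (y * L₁ ν)) 0 (δs ν 5 - δs ν 0)| :=
    eventually_dslope_exp_gt (fun ν => δs ν 5 - δs ν 0) L₁ hw0 hL₁ 0 (8 / κ₁) le_rfl (by positivity)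
  have g2b : ∀ᶠ ν in atTop, 8 / κ₂ * Real.exp ((δs ν 5 - δs ν 0) * L₁ ν) + 0
      < |dslope (fun y : ℝ => Real.exp (y * L₁ ν)) 0 (δs ν 5 - δs ν 0)| :=
    eventually_dslope_exp_gt (fun ν => δs ν 5 - δs ν 0) L₁ hw0 hL₁ (8 / κ₂) 0 (by positivity) le_rfl
  have g3a : ∀ᶠ ν in atTop, 0 * Real.exp ((δs ν 5 - δs ν 0) * (L₁ ν + L₂ ν)) + 8 / κ₁
      < |dslope (fun y : ℝ => Real.exp (y * (L₁ ν + L₂ ν))) 0 (δs ν 5 - δs ν 0)| :=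
    eventually_dslope_exp_gt (fun ν => δs ν 5 - δs ν 0) (fun ν => L₁ ν + L₂ ν) hw0 hL₃ 0 (8 / κ₁) le_rfl (by positivity)
  have g3b : ∀ᶠ ν in atTop, 8 / κ₃ * Real.exp ((δs ν 5 - δs ν 0) * (L₁ ν + L₂ ν)) + 0
      < |dslope (fun y : ℝ => Real.exp (y * (L₁ ν + L₂ ν))) 0 (δs ν 5 - δs ν 0)| :=
    eventually_dslope_exp_gt (fun ν => δs ν 5 - δs ν 0) (fun ν => L₁ ν + L₂ ν) hw0 hL₃ (8 / κ₃) 0 (by positivity) le_rfl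
  have gDa : ∀ᶠ ν in atTop, 0 * Real.exp ((δs ν 5 - δs ν 0) * L₂ ν) + 8 / κ₂
      < |dslope (fun y : ℝ => Real.exp (y * L₂ ν)) 0 (δs ν 5 - δs ν 0)| :=
    eventually_dslope_exp_gt (fun ν => δs ν 5 - δs ν 0) L₂ hw0 hL₂ 0 (8 / κ₂) le_rfl (by positivity)
  have gDb : ∀ᶠ ν in atTop, 8 / κ₃ * Real.exp ((δs ν 5 - δs ν 0) * L₂ ν) + 0
      < |dslope (fun y : ℝ => Real.exp (y * L₂ ν)) 0 (δs ν 5 - δs ν 0)| :=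
    eventually_dslope_exp_gt (fun ν => δs ν 5 - δs ν 0) L₂ hw0 hL₂ (8 / κ₃) 0 (by positivity) le_rfl
  have hfalse : ∀ᶠ ν : ℕ in atTop, False := by
    filter_upwards [e1, e2, e3, g2a, g2b, g3a, g3b, gDa, gDb] with ν hν1 hν2 hν3 q2a q2b q3a q3b qDa qDb
    obtain ⟨-, i05₂, i00₂⟩ := triple_frameShift (δs ν) (U ν) (L₁ ν)
    obtain ⟨-, i05₃, i00₃⟩ := triple_frameShift (δs ν) (U ν) (L₁ ν + L₂ ν)
    set w := δs ν 5 - δs ν 0 with hw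
    set g55 := polar (w • U ν 5) (w • U ν 5) with hg55
    set g05 := polar (U ν 0 + U ν 5) (w • U ν 5) with hg05
    set g00 := polar (U ν 0 + U ν 5) (U ν 0 + U ν 5) with hg00
    set Λ₂ := dslope (fun y : ℝ => Real.exp (y * L₁ ν)) 0 w with hΛ₂
    set Λ₃ := dslope (fun y : ℝ => Real.exp (y * (L₁ ν + L₂ ν))) 0 w with hΛ₃
    set D := dslope (fun y : ℝ => Real.exp (y * L₂ ν)) 0 w with hD
    set E₂ := Real.exp (δs ν 0 * L₁ ν) with hE₂
    set E₃ := Real.exp (δs ν 0 * (L₁ ν + L₂ ν)) with hE₃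
    set e₂ := Real.exp (w * L₁ ν) with he₂
    set e₃ := Real.exp (w * (L₁ ν + L₂ ν)) with he₃
    set d := Real.exp (w * L₂ ν) with hd
    have hE₂pos : 0 < E₂ := Real.exp_pos _
    have hE₃pos : 0 < E₃ := Real.exp_pos _
    have he₂pos : 0 < e₂ := Real.exp_pos _
    have he₃pos : 0 < e₃ := Real.exp_pos _
    have hdpos : 0 < d := Real.exp_pos _
    have h00le : |g00| ≤ μ₁ ν := by have := hdom₁ ν 0 0; simp only [h05', if_false, if_true] at this; exact this
    -- cluster 2: κ₂ |g00^{(2)}| ≤ |g05^{(2)}|, with the E² factors divided out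
    have c2 : κ₂ * |g00 + 2 * Λ₂ * g05 + Λ₂ * Λ₂ * g55| ≤ e₂ * |g05 + Λ₂ * g55| := by
      have hd00 := hdom₂ ν 0 0
      simp only [h05', if_false, if_true] at hd00
      rw [i00₂, abs_mul, abs_of_pos (mul_pos hE₂pos hE₂pos)] at hd00
      rw [i05₂, abs_mul, abs_of_pos (by positivity)] at hν2
      have : (κ₂ * |g00 + 2 * Λ₂ * g05 + Λ₂ * Λ₂ * g55|) * (E₂ * E₂) ≤ (e₂ * |g05 + Λ₂ * g55|) * (E₂ * E₂) := by
        calc (κ₂ * |g00 + 2 * Λ₂ * g05 + Λ₂ * Λ₂ * g55|) * (E₂ * E₂) = κ₂ * (E₂ * E₂ * |g00 + 2 * Λ₂ * g05 + Λ₂ * Λ₂ * g55|) := by ring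
          _ ≤ κ₂ * μ₂ ν := mul_le_mul_of_nonneg_left hd00 hκ₂pos.le
          _ ≤ E₂ * E₂ * e₂ * |g05 + Λ₂ * g55| := hν2
          _ = (e₂ * |g05 + Λ₂ * g55|) * (E₂ * E₂) := by ring
      exact le_of_mul_le_mul_right this (by positivity)
    have c3 : κ₃ * |g00 + 2 * Λ₃ * g05 + Λ₃ * Λ₃ * g55| ≤ e₃ * |g05 + Λ₃ * g55| := by
      have hd00 := hdom₃ ν 0 0
      simp only [h05', if_false, if_true] at hd00
      rw [i00₃, abs_mul, abs_of_pos (mul_pos hE₃pos hE₃pos)] at hd00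
      rw [i05₃, abs_mul, abs_of_pos (by positivity)] at hν3
      have : (κ₃ * |g00 + 2 * Λ₃ * g05 + Λ₃ * Λ₃ * g55|) * (E₃ * E₃) ≤ (e₃ * |g05 + Λ₃ * g55|) * (E₃ * E₃) := by
        calc (κ₃ * |g00 + 2 * Λ₃ * g05 + Λ₃ * Λ₃ * g55|) * (E₃ * E₃) = κ₃ * (E₃ * E₃ * |g00 + 2 * Λ₃ * g05 + Λ₃ * Λ₃ * g55|) := by ring
          _ ≤ κ₃ * μ₃ ν := mul_le_mul_of_nonneg_left hd00 hκ₃pos.le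
          _ ≤ E₃ * E₃ * e₃ * |g05 + Λ₃ * g55| := hν3
          _ = (e₃ * |g05 + Λ₃ * g55|) * (E₃ * E₃) := by ring
      exact le_of_mul_le_mul_right this (by positivity)
    -- the nested-shift identity and `e₃ = e₂ d`
    have hDrel : Λ₃ - Λ₂ = e₂ * D := dslope_exp_shift_sub (L₁ ν) (L₂ ν) w
    have he₃eq : e₃ = e₂ * d := by rw [he₃, he₂, hd, ← Real.exp_add]; congr 1; ring
    -- growth bounds in the form the core wants
    rw [zero_mul, zero_add] at q2a q3a qDa
    rw [add_zero] at q2b q3b qDb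
    have b2a : 8 ≤ κ₁ * |Λ₂| := by
      have := mul_le_mul_of_nonneg_left q2a.le hκ₁pos.le
      rw [show κ₁ * (8 / κ₁) = 8 by field_simp] at this; exact this
    have b2b : 8 * e₂ ≤ κ₂ * |Λ₂| := by
      have := mul_le_mul_of_nonneg_left q2b.le hκ₂pos.le
      rw [show κ₂ * (8 / κ₂ * e₂) = 8 * e₂ by field_simp] at this; exact this
    have b3a : 8 ≤ κ₁ * |Λ₃| := by
      have := mul_le_mul_of_nonneg_left q3a.le hκ₁pos.le
      rw [show κ₁ * (8 / κ₁) = 8 by field_simp] at this; exact this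
    have b3b : 8 * e₃ ≤ κ₃ * |Λ₃| := by
      have := mul_le_mul_of_nonneg_left q3b.le hκ₃pos.le
      rw [show κ₃ * (8 / κ₃ * e₃) = 8 * e₃ by field_simp] at this; exact this
    have bDa : 8 * e₂ ≤ κ₂ * |e₂ * D| := by
      have h8 := mul_le_mul_of_nonneg_left qDa.le hκ₂pos.le
      rw [show κ₂ * (8 / κ₂) = 8 by field_simp] at h8
      rw [abs_mul, abs_of_pos he₂pos]
      calc 8 * e₂ = e₂ * 8 := by ring
        _ ≤ e₂ * (κ₂ * |D|) := mul_le_mul_of_nonneg_left h8 he₂pos.le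
        _ = κ₂ * (e₂ * |D|) := by ring
    have bDb : 8 * e₃ ≤ κ₃ * |e₂ * D| := by
      have h8 := mul_le_mul_of_nonneg_left qDb.le hκ₃pos.le
      rw [show κ₃ * (8 / κ₃ * d) = 8 * d by field_simp] at h8
      rw [abs_mul, abs_of_pos he₂pos, he₃eq]
      calc 8 * (e₂ * d) = e₂ * (8 * d) := by ring
        _ ≤ e₂ * (κ₃ * |D|) := mul_le_mul_of_nonneg_left h8 he₂pos.le
        _ = κ₃ * (e₂ * |D|) := by ring
    exact three_opposite_core hκ₁pos hκ₂pos hκ₃pos (hμ₁ ν) he₂pos hν1 h00le c2 c3 hDrel b2a b2b b3a b3b bDa bDb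
  exact hfalse.exists.elim fun _ h => h

end Summit.ValiantsHypothesis.ValiantsHypothesis.Theorems.LacunarySymmetroidMatrixDescartes.WallBubbling
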